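import Mathlib
import Summits.ValiantsHypothesis.ValiantsHypothesis.Theses.RigidMinimalReps
import Summits.ValiantsHypothesis.ValiantsHypothesis.Theorems.RigidMinimalRepsOrbitsForceTorusAction
import Literature.Computability.AlgebraicComplexity.DetReprEquivalent
import Literature.Computability.AlgebraicComplexity.LRPencilOfMatrix
import Summits.ValiantsHypothesis.ValiantsHypothesis.Theorems.RigidMinimalRepsMinimalRepTorusSymmetricStubInitialForm
import Summits.ValiantsHypothesis.ValiantsHypothesis.Theorems.RigidMinimalRepsMinimalRepTorusSymmetricStubTightLifts

/-!
# `RigidMinimalReps.MinimalRepTorusSymmetric` (crux stmt-ValiantsHypothesis-5112) — birth skeleton (BC3)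

Crux (rank 0, the auto-cruxed TARGET `X` of route-ValiantsHypothesis-RigidMinimalReps), BY NAME:
`Summit.ValiantsHypothesis.ValiantsHypothesis.Theses.RigidMinimalReps.MinimalRepTorusSymmetric` —
for all large `n`, `per_n` has an affine determinantal representation of size EXACTLY `dc(per_n)` with
exact `GL_s × GL_s`-lifts of every two-sided torus substitution `x_{kl} ↦ d_k e_l x_{kl}`
("the optimum is torus-symmetric", `edc_T(per_n) = dc(per_n)`; LR17 §2.1, the question after Q2.2, for
the connected part of `G_{per}`).

The route reaches `X` through `OrbitsForceTorus : DoublyMinimalFinite → X` (PROVED in the tree,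
`orbitsForceTorus_proof`: finitely many gauge orbits on the doubly-minimal locus + divisibility of the
torus).  This skeleton registers a SECOND, independent line on `X` that needs no finiteness of orbits:

## The line: no bottom cancellation ⇒ bigraded initial form ⇒ exact torus lifts  (BB-sink of the gauge class)

Notation: `n` = size of the permanent, `s` = size of the matrix, `A = Λ + Σ_{kl} x_{kl} A_{kl}` affine
(`constPart A = Λ`, `LRPencil.coeffMat A (k,l) = A_{kl}`).  Weights live in the character lattice of the
two-sided torus `T = (ℂˣ)ⁿ × (ℂˣ)ⁿ`, written `M = (Fin n → ℤ) × (Fin n → ℤ)` (componentwise order):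
the variable `x_{kl}` has weight `(e_k, e_l)` (`= (Pi.single k 1, Pi.single l 1)`), a constant has
weight `0`, and every monomial of `per_n` has weight `𝟙 = (1, 1)` (the constant-one pair, `1 : M`).

* A pair of ROW/COLUMN POTENTIALS `α, β : Fin s → M` is a **sub-potential** for `A` if every monomial
  present in the entry `A i j` has weight `≥ α i + β j` (i.e. `Λ_{ij} ≠ 0 ⇒ α i + β j ≤ 0` and
  `(A_{kl})_{ij} ≠ 0 ⇒ α i + β j ≤ (e_k, e_l)`) and `Σ_i α i + Σ_j β j = 𝟙`; it is **tight** if the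
  inequalities are equalities on the support.  A tight `A` is exactly a `T`-BIGRADED matrix (entries are
  weight vectors for the characters `-α i` on rows and `β j` on columns); Grenet's `(2ⁿ-1) × (2ⁿ-1)`
  representation is tight (vertex `S ⊆ [n]` of the layered ABP has weight `(𝟙_{[|S|]}, 𝟙_S)`).
* **Stub 1 (`stub_subPotentials`, the heart):** for all large `n` SOME optimal (size `dc(per_n)`)
  affine determinantal representation of `per_n` admits a sub-potential.  By König–Egerváry duality
  (the `2n` coordinates of `M` are independent scalar potential systems; Kuhn 1955 §2) this says: for
  every row index `k`, EVERY perfect matching of the support pattern `{(i,j) : A i j ≠ 0}` uses an entry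
  consisting only of row-`k` variables (no constant, no other row), and likewise for every column index
  `l` — equivalently, along each of the `2n` coordinate one-parameter subgroups `λ` of `T` the lowest-order
  terms of `det A(λ(t)·x) = t · per_n` do NOT cancel ("no bottom cancellation", the Białynicki-Birula /
  Hilbert–Mumford reading recorded in the crux's `why it might fail`).
* **Stub 2 (`stub_initialForm`, the limit lemma):** if `A` (any affine determinantal representation of
  `per_n`, any `n, s`) admits a sub-potential `α, β`, then the INITIAL FORM `A⁰` (keep in `A i j` exactly
  the monomials of weight `α i + β j`) is again an affine determinantal representation of `per_n` of the
  same size, with smaller support, and TIGHT.  Proof in one line: in `det A = Σ_π ± Π_i A_{i,π i}` every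
  product of present monomials has weight `Σ_i ω_i ≥ Σ_i (α i + β (π i)) = 𝟙`, with equality iff every
  factor is tight, so the weight-`𝟙` component of `det A` is `det A⁰`; and `per_n` is weight-`𝟙`
  homogeneous.  (`A⁰` is the limit `lim_{t→0} t^{-α} · A(λ(t)x) · t^{-β}` of the gauge class along a
  dominant 1-PS — the BB-sink; stated existentially, so the prover may construct `A'` as he likes.)
* **Stub 3 (`stub_tightLifts`, graded ⇒ equivariant):** a tight affine matrix satisfies
  `A(d_k e_l x_{kl}) = diag(χ_{α i}(d,e)) · A · diag(χ_{β j}(d,e))` with the Laurent monomials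
  `χ_{(a,b)}(d,e) = Π_k d_k^{a_k} Π_l e_l^{b_l}`, for all nonvanishing `d, e` — an exact lift by DIAGONAL
  constant gauge matrices (no determinant hypothesis needed).
* **Composition (`MinimalRepTorusSymmetric_of`, sorry-free):** stub 1 gives an optimal `A` with a
  sub-potential at `s = dc(per_n)`; stub 2 gives a tight optimal `A'`; stub 3 lifts the generators
  `diag(d) ⊗ diag(e)` of the two-sided torus; exact lifts are closed under `1, *, ⁻¹`
  (`lifts_one/mul/inv`, tree: `RigidMinimalRepsOrbitsForceTorusAction`), so `Subgroup.closure_induction`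
  and `isEquivariantDetRepr_iff_exists_mul_mul` give `HasEquivariantDetRepr Γ_T per_n (dc per_n)`, i.e. the
  crux BY NAME.

Why this is a genuine cut and not a costume.  Stub 1 is strictly weaker in FORM than "some optimal
representation is bigraded" (inequalities, not equalities: `A` itself need not be graded, only its
bottom) and is a finite matching condition on ONE support pattern, decidable by the Hungarian method
for any concrete `A` (n = 3: Grenet's 7 × 7 passes with equality); stub 2 is the deformation step that
upgrades inequalities to a graded REPRESENTATION (the content of "limits of optimal gauge classes along
dominant 1-PS stay optimal representations when the bottom does not cancel"); stub 3 is the algebra of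
characters.  Conversely `X ⇒ stub 1` is expected at the level of truth (a homomorphic lift from a maximal
torus of the algebraic group `𝔾_A`, LR17 §1/§3, diagonalises `A` into a bigraded gauge-equivalent
matrix; retract the characters rationally to `M` and shift to integers blockwise) but is a real theorem,
not a cheap implication: stub 1 is the crux's combinatorial shadow with the same expected truth value
and a different handle (matching theory / supports instead of lifts / orbits).  No stub is comparable
to the crux or to `ValiantsHypothesis` by `exact? | simpa | aesop` (BC3 probes, registrar folder
`bc/MinimalRepTorusSymmetric_probes{,_split}.lean`: 6/6 FAIL; dedup `example : stub := by exact?` 3/3 FAIL).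

Gauge-twist check (crux typing checklist (i)): stub 1 is EXISTENTIAL in `A`, so polynomial gauge twists
of a good representation (the move that refuted `GrenetRigidity.OptimalUnique`, negatives index) cannot
touch it; stubs 2 and 3 are universal but carry their hypotheses explicitly and are proved on paper above.

**Disproof used.** None exists: `Cruxes/MinimalRepTorusSymmetric/` had no workfiles (no `Disproof.lean`,
no `Negative/` lemma, no dead lines) at registration (2026-08-17); `ledger negatives --problem
ValiantsHypothesis` (4 entries: UlrichPadded `NoTightInfinity`, an Elusive candidate, GrenetRigidity
`OptimalUnique` ×2) — uniqueness of optimal representations (refuted) is NOT used: the line needs ONE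
good optimal representation, not all.  Crux evidence `GRENET3-TANGENT.md` (rescuer lens: Zariski tangent
at Grenet(3) = gauge + two-sided linear null transvections) concerns the finiteness line
(`DoublyMinimalFinite`), not this one.  Hardest stub: `stub_subPotentials`.

## Shape (skeleton audit by-name rule, as in `Cruxes/TorusBound/Lines/birth.lean`)
* `Stmt.stub_…` — the three stub statements as precise `Prop`s, named like the stubs;
* `stub_…` — the same statements as sorried theorems (the REGISTERED stubs; `sorry` occurs nowhere else);
* `MinimalRepTorusSymmetric_of` — the composition, real proof; `MinimalRepTorusSymmetric_proof` — the
  crux by name from the stubs.  Each stub can land as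
  `Theorems/RigidMinimalRepsMinimalRepTorusSymmetric<Stub>.lean --supports stmt-ValiantsHypothesis-5112`.
-/

namespace Summit.ValiantsHypothesis.ValiantsHypothesis.Cruxes.MinimalRepTorusSymmetric.Birth

open Matrix MvPolynomial Finset
open Literature.Computability.AlgebraicComplexity LRPencil
open Summit.ValiantsHypothesis.ValiantsHypothesis.Theorems.RigidMinimalRepsOrbitsForceTorus

-- `Summit.ValiantsHypothesis.ValiantsHypothesis.…` is the tree's mandated single-conjunct layout (Sub = Summit).
set_option linter.dupNamespace false

noncomputable section

/-! ## §1 The three stub statements as `Prop`s (named like the registered stubs) -/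

/-- Statement of stub 1 (`stub_subPotentials`) — **some optimal representation has no bottom
cancellation in any coordinate direction of the two-sided torus.**  For all large `n`, at
`s = dc(per_n)`, there is an affine determinantal representation `A` of `per_n` of size `s` and
row/column potentials `α, β : Fin s → (Fin n → ℤ) × (Fin n → ℤ)` with
`Λ_{ij} ≠ 0 ⇒ α i + β j ≤ 0`, `(A_{kl})_{ij} ≠ 0 ⇒ α i + β j ≤ (e_k, e_l)` (componentwise) and
`Σ α + Σ β = 𝟙` (the weight of `per_n`).  Equivalently (König–Egerváry, coordinatewise): for every row
`k` (column `l`) of the permanent, every perfect matching of the support pattern of `A` uses an entry made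
only of row-`k` (column-`l`) variables.  The heart of the line; size XL.
[cite: LandsbergRessayre2017, §2.1] [cite: Kuhn1955, §2] [cite: Grenet2011] -/
def Stmt.stub_subPotentials : Prop :=
  ∃ n₀ : ℕ, ∀ n ≥ n₀, ∀ s : ℕ, determinantalComplexity (perPoly (Fin n) ℂ) = s →
    ∃ A : Matrix (Fin s) (Fin s) (MvPolynomial (Fin n × Fin n) ℂ),
      IsAffineDetRepr (perPoly (Fin n) ℂ) A ∧
      ∃ α β : Fin s → (Fin n → ℤ) × (Fin n → ℤ),
        (∀ i j, constPart A i j ≠ 0 → α i + β j ≤ 0) ∧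
        (∀ i j (v : Fin n × Fin n), coeffMat A v i j ≠ 0 →
          α i + β j ≤ ((Pi.single v.1 1 : Fin n → ℤ), (Pi.single v.2 1 : Fin n → ℤ))) ∧
        ∑ i, α i + ∑ j, β j = 1

/-- Statement of stub 2 (`stub_initialForm`) — **the initial form along a sub-potential is again a
representation, and it is tight.**  For ANY affine determinantal representation `A` of `per_n` (any
`n, s`) with a sub-potential `α, β`, there is an affine determinantal representation `A'` of `per_n` of
the same size whose entries have supports inside those of `A` and which is TIGHT:
`Λ'_{ij} ≠ 0 ⇒ α i + β j = 0`, `(A'_{kl})_{ij} ≠ 0 ⇒ α i + β j = (e_k, e_l)`.  (Take `A' = A⁰`, the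
truncation of every entry to its monomials of weight exactly `α i + β j`: the weight-`𝟙` component of
`det A` is `det A⁰`, and `per_n` is weight-`𝟙` homogeneous — the Białynicki-Birula sink of the gauge
class along a dominant one-parameter subgroup.)  Size M (L in Lean: `weightedHomogeneousComponent`
bookkeeping in `Matrix.det_apply`). [cite: Bialynickibirula1973, Thm. 4.1] [cite: LandsbergRessayre2017, §3] -/
def Stmt.stub_initialForm : Prop :=
  ∀ (n s : ℕ) (A : Matrix (Fin s) (Fin s) (MvPolynomial (Fin n × Fin n) ℂ))
    (α β : Fin s → (Fin n → ℤ) × (Fin n → ℤ)),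
    IsAffineDetRepr (perPoly (Fin n) ℂ) A →
    (∀ i j, constPart A i j ≠ 0 → α i + β j ≤ 0) →
    (∀ i j (v : Fin n × Fin n), coeffMat A v i j ≠ 0 →
      α i + β j ≤ ((Pi.single v.1 1 : Fin n → ℤ), (Pi.single v.2 1 : Fin n → ℤ))) →
    ∑ i, α i + ∑ j, β j = 1 →
    ∃ A' : Matrix (Fin s) (Fin s) (MvPolynomial (Fin n × Fin n) ℂ),
      IsAffineDetRepr (perPoly (Fin n) ℂ) A' ∧
      (∀ i j, (A' i j).support ⊆ (A i j).support) ∧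
      (∀ i j, constPart A' i j ≠ 0 → α i + β j = 0) ∧
      (∀ i j (v : Fin n × Fin n), coeffMat A' v i j ≠ 0 →
        α i + β j = ((Pi.single v.1 1 : Fin n → ℤ), (Pi.single v.2 1 : Fin n → ℤ)))

/-- Statement of stub 3 (`stub_tightLifts`) — **a tight (bigraded) affine matrix has DIAGONAL exact
lifts of the whole two-sided torus.**  If every constant of `A` sits where `α i + β j = 0` and every
occurrence of `x_{kl}` where `α i + β j = (e_k, e_l)`, then for all nonvanishing `d, e : Fin n → ℂ`,
`A(d_k e_l x_{kl}) = P · A · Q` with `P = diag(χ_{α i}(d,e))`, `Q = diag(χ_{β j}(d,e))`,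
`χ_{(a,b)}(d,e) = Π_k d_k^{a_k} · Π_l e_l^{b_l}` (integer powers of units).  Size M.
[cite: LandsbergRessayre2017, Def. 1.3] -/
def Stmt.stub_tightLifts : Prop :=
  ∀ (n s : ℕ) (A : Matrix (Fin s) (Fin s) (MvPolynomial (Fin n × Fin n) ℂ))
    (α β : Fin s → (Fin n → ℤ) × (Fin n → ℤ)),
    (∀ i j, (A i j).totalDegree ≤ 1) →
    (∀ i j, constPart A i j ≠ 0 → α i + β j = 0) →
    (∀ i j (v : Fin n × Fin n), coeffMat A v i j ≠ 0 →
      α i + β j = ((Pi.single v.1 1 : Fin n → ℤ), (Pi.single v.2 1 : Fin n → ℤ))) →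
    ∀ (d e : Fin n → ℂ), (∀ k, d k ≠ 0) → (∀ l, e l ≠ 0) →
      ∃ P Q : GL (Fin s) ℂ,
        A.map (linSubst (Fin n × Fin n) ℂ (Matrix.diagonal fun p => d p.1 * e p.2)) =
          (P : Matrix (Fin s) (Fin s) ℂ).map C * A * (Q : Matrix (Fin s) (Fin s) ℂ).map C

/-! ## §2 Registered stubs (the ONLY sorries of this file) -/

/-- **Registered stub 1 = `Stmt.stub_subPotentials`** (some optimal representation of `per_n`, `n`
large, admits a two-sided sub-potential: no bottom cancellation along any coordinate 1-PS of the torus;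
the heart of the line, size XL). [cite: LandsbergRessayre2017, §2.1] [cite: Kuhn1955, §2] -/
theorem stub_subPotentials :
    ∃ n₀ : ℕ, ∀ n ≥ n₀, ∀ s : ℕ, determinantalComplexity (perPoly (Fin n) ℂ) = s →
    ∃ A : Matrix (Fin s) (Fin s) (MvPolynomial (Fin n × Fin n) ℂ),
      IsAffineDetRepr (perPoly (Fin n) ℂ) A ∧
      ∃ α β : Fin s → (Fin n → ℤ) × (Fin n → ℤ),
        (∀ i j, constPart A i j ≠ 0 → α i + β j ≤ 0) ∧
        (∀ i j (v : Fin n × Fin n), coeffMat A v i j ≠ 0 →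
          α i + β j ≤ ((Pi.single v.1 1 : Fin n → ℤ), (Pi.single v.2 1 : Fin n → ℤ))) ∧
        ∑ i, α i + ∑ j, β j = 1 := by
  sorry

/-- **Registered stub 2 = `Stmt.stub_initialForm`** (the initial form of a representation along a
sub-potential is a tight representation of the same size: weight-`𝟙` component of `det A`; size M/L).
[cite: Bialynickibirula1973, Thm. 4.1] -/
theorem stub_initialForm :
    ∀ (n s : ℕ) (A : Matrix (Fin s) (Fin s) (MvPolynomial (Fin n × Fin n) ℂ))
    (α β : Fin s → (Fin n → ℤ) × (Fin n → ℤ)),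
    IsAffineDetRepr (perPoly (Fin n) ℂ) A →
    (∀ i j, constPart A i j ≠ 0 → α i + β j ≤ 0) →
    (∀ i j (v : Fin n × Fin n), coeffMat A v i j ≠ 0 →
      α i + β j ≤ ((Pi.single v.1 1 : Fin n → ℤ), (Pi.single v.2 1 : Fin n → ℤ))) →
    ∑ i, α i + ∑ j, β j = 1 →
    ∃ A' : Matrix (Fin s) (Fin s) (MvPolynomial (Fin n × Fin n) ℂ),
      IsAffineDetRepr (perPoly (Fin n) ℂ) A' ∧
      (∀ i j, (A' i j).support ⊆ (A i j).support) ∧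
      (∀ i j, constPart A' i j ≠ 0 → α i + β j = 0) ∧
      (∀ i j (v : Fin n × Fin n), coeffMat A' v i j ≠ 0 →
        α i + β j = ((Pi.single v.1 1 : Fin n → ℤ), (Pi.single v.2 1 : Fin n → ℤ))) :=
  -- LANDED (p147746): Theorems/RigidMinimalRepsMinimalRepTorusSymmetricStubInitialForm.lean
  Summit.ValiantsHypothesis.ValiantsHypothesis.Theorems.RigidMinimalRepsMinimalRepTorusSymmetric.stub_initialForm

/-- **Registered stub 3 = `Stmt.stub_tightLifts`** (a tight affine matrix has diagonal exact lifts
`A(d_k e_l x_{kl}) = diag(χ_α) A diag(χ_β)` of every two-sided torus element; size M).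
[cite: LandsbergRessayre2017, Def. 1.3] -/
theorem stub_tightLifts :
    ∀ (n s : ℕ) (A : Matrix (Fin s) (Fin s) (MvPolynomial (Fin n × Fin n) ℂ))
    (α β : Fin s → (Fin n → ℤ) × (Fin n → ℤ)),
    (∀ i j, (A i j).totalDegree ≤ 1) →
    (∀ i j, constPart A i j ≠ 0 → α i + β j = 0) →
    (∀ i j (v : Fin n × Fin n), coeffMat A v i j ≠ 0 →
      α i + β j = ((Pi.single v.1 1 : Fin n → ℤ), (Pi.single v.2 1 : Fin n → ℤ))) →
    ∀ (d e : Fin n → ℂ), (∀ k, d k ≠ 0) → (∀ l, e l ≠ 0) →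
      ∃ P Q : GL (Fin s) ℂ,
        A.map (linSubst (Fin n × Fin n) ℂ (Matrix.diagonal fun p => d p.1 * e p.2)) =
          (P : Matrix (Fin s) (Fin s) ℂ).map C * A * (Q : Matrix (Fin s) (Fin s) ℂ).map C :=
  -- LANDED (p148847): Theorems/RigidMinimalRepsMinimalRepTorusSymmetricStubTightLifts.lean
  Summit.ValiantsHypothesis.ValiantsHypothesis.Theorems.RigidMinimalRepsMinimalRepTorusSymmetric.stub_tightLifts

/-! ## §3 The composition (kernel-checked, sorry-free) -/

/-- **The crux from the three stubs** (real proof).  For `n ≥ n₀` (stub 1's threshold) and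
`s = dc(per_n)`: (1) stub 1 gives an optimal representation `A` with a sub-potential `α, β`;
(2) stub 2 gives a TIGHT optimal representation `A'` of the same size; (3) stub 3 lifts every generator
`γ = diag(d_k e_l)` of the two-sided torus to a diagonal gauge pair, and exact lifts are closed under the
group operations (`lifts_one/mul/inv`), so `Subgroup.closure_induction` makes `A'` equivariant for the
whole generated subgroup; `isEquivariantDetRepr_iff_exists_mul_mul` repackages `(P, Q)` as `(g, h⁻¹)`.
[cite: LandsbergRessayre2017, Def. 1.3, §2.1] -/
theorem MinimalRepTorusSymmetric_of :
    Stmt.stub_subPotentials → Stmt.stub_initialForm → Stmt.stub_tightLifts →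
      Summit.ValiantsHypothesis.ValiantsHypothesis.Theses.RigidMinimalReps.MinimalRepTorusSymmetric := by
  intro h₁ h₂ h₃
  unfold Stmt.stub_subPotentials at h₁
  unfold Stmt.stub_initialForm at h₂
  unfold Stmt.stub_tightLifts at h₃
  classical
  obtain ⟨n₀, hn₀⟩ := h₁
  refine ⟨n₀, fun n hn => ?_⟩
  -- work at a fixed size `s = dc(per_n)` (generalised, to keep `dc` opaque)
  obtain ⟨s, hs⟩ : ∃ s : ℕ, determinantalComplexity (perPoly (Fin n) ℂ) = s := ⟨_, rfl⟩
  rw [hs]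
  -- (1) stub 1: an optimal representation `A` with a two-sided sub-potential `α, β`
  obtain ⟨A, hA, α, β, hP₀, hP₁, hsum⟩ := hn₀ n hn s hs
  -- (2) stub 2: its initial form `A'` is again an optimal representation, now TIGHT for `α, β`
  obtain ⟨A', hA', -, hT₀, hT₁⟩ := h₂ n s A α β hA hP₀ hP₁ hsum
  -- (3) stub 3 on the generators + closure under the group operations: `A'` is torus-equivariant
  refine ⟨A', isEquivariantDetRepr_iff_exists_mul_mul.2 ⟨hA', fun γ hγ => ?_⟩⟩
  induction hγ using Subgroup.closure_induction with
  | one => exact lifts_one A'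
  | mul x y _ _ hx hy => exact lifts_mul hx hy
  | inv x _ hx => exact lifts_inv hx
  | mem γ hγ =>
    obtain ⟨d, e, hd, he, hγe⟩ := hγ
    obtain ⟨P, Q, hPQ⟩ := h₃ n s A' α β hA'.1 hT₀ hT₁ d e hd he
    refine ⟨P, Q, ?_⟩
    show A'.map (linSubst (Fin n × Fin n) ℂ (γ : Matrix (Fin n × Fin n) (Fin n × Fin n) ℂ)) = _
    rw [hγe]
    exact hPQ

/-- **THE SKELETON: the crux BY NAME, modulo exactly the three registered stubs** (the compiler
checks that the `Stmt` copies and the stub statements agree). [cite: LandsbergRessayre2017, §2.1] -/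
theorem MinimalRepTorusSymmetric_proof :
    Summit.ValiantsHypothesis.ValiantsHypothesis.Theses.RigidMinimalReps.MinimalRepTorusSymmetric :=
  MinimalRepTorusSymmetric_of stub_subPotentials stub_initialForm stub_tightLifts

end

end Summit.ValiantsHypothesis.ValiantsHypothesis.Cruxes.MinimalRepTorusSymmetric.Birth
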